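import Summits.QuantumFields.YangMills.Theorems.UnitScaleTiltProp7SymFrameCovDefs
import Summits.QuantumFields.YangMills.Theorems.UnitScaleTiltProp8ChartIterSmall
import HarnessLib

/-!
# `UnitScaleTiltProp7SymFrameIterSmall` — W2 OF THE (47)-twˢ PLAN (OWNER RULINGS g26-№12∕№13): **k-UNIFORM SMALLNESS OF THE COVARIANT DOUBLE-BAR TOWER RELATIVE TO THE BACKGROUND
# TOWER AND OF THE ACCUMULATED SYMMETRIC FRAMES** — the covariant twin of ✓B2 `Prop8ChartDoubleBar.norm_dbarIterU_sub_one_le_of_reads` for ★w5-20520 g3's ✓p614452 objects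
# `dbarCovIterU`∕`frameAccU` ([Balaban1985Averaging] (159)–(163) for the centred, symmetrised frames of RULING g26-№12): on a set `S` of level-`i` sites under which the background `U₀`
# has reads `s₀` and the full field `W` differs from it by `δ`, `‖U̿^{(i)}(e) − Ū₀^{(i)}(e)‖ ≤ x(1 + Dℓ²x)` and `‖w^{(i)}(y) − 1‖ ≤ 6ℓx` with `x = Lⁱ(δ + 30ℓs₀)` — LINEAR in the
# level-scaled reads, hence k-uniform at the T³ letters; the covariant ONE-STEP rows enter as displayed hypotheses `hstep`∕`hframe` (suppliers: ★w4-19200 g3's W1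
# `Prop7SymAvgTwSym.norm_dbarCovU_mul_inv_sub_one_le`∕`norm_vframeCovU_sub_one_le_of_diff`, ⧗p615545 + part 2), the background tower's smallness is ✓`Prop8Chart.norm_emlIterU_sub_one_le_of_reads`
# (route `UnitScaleTilt`, crux K1 «MinimiserStabilityRegPr» stmt-QuantumFields-19200, stub `stub_existenceMinimalOrbit` (EX), route (α), node (AVG-SYM); def-free, count-neutral)

Cell `ym3-torus` (HUMAN RULING D-0037, YM ladder rung R3 — YM₃ on T³ is a rung, not d = 4, not a mass gap, not Clay), width seat `ym-ust-20520-w4` (gen 3), W2 of the (47)-twˢ brick list of record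
(RULING g26-№13 (iii)); the input of W3 (the `dbarTwS` window) and of W4 (★w3-20520 g4's analyticity∕Cauchy rows).

THE PRINT.  [Balaban1985Averaging] p. 42 (159)–(163): «|U̿₁ʲ − 1| ≤ |Q_j| ≤ 2α₂ … |v_j(y) − 1|, |v_j(y)⁻¹ − 1| ≤ O(1)dLʲ|A|»; (97) p. 32 (accumulated frames), (127) p. 37 (the recomputed tower),
Prop. 4 (134)–(135) p. 38; p. 44: «all operations needed to define R̄₀uᵏ are done always in a case where proper expressions are small».

WHAT IS PROVED (sorry-free, no definition; generic `P : Params`, complete normed ℂ-algebra `𝔸` with `‖1‖ = 1`; `ℓ = (d+2)L`, `D = 16C₁ + 2`):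
* §1 arithmetic: `norm_mul_sub_one_le_three`, `norm_sub_le_norm_mul_inv_sub_one_mul`, `budget_consequences`, `step_budget_cov` (the difference recursion closes), `step_frame_cov` (the frame
  recursion closes).
* §2 ★★**`diff_frameAccU_le_of_reads`** — for every level `i ≤ m + K`, every `S ⊆ T^{(i)}`, reads `‖U₀(b) − 1‖ ≤ s₀`, `‖W(b) − U₀(b)‖ ≤ δ` on the fine bonds under `S`, budgets `6400ℓ²Lⁱs₀ ≤ 1`
  and `8Dℓ²·Lⁱ(δ + 30ℓs₀) ≤ 1`: `‖U̿^{(i)}(e) − Ū₀^{(i)}(e)‖ ≤ x(1 + Dℓ²x)` on the `i`-bonds of `S` and `‖w^{(i)}(y) − 1‖ ≤ 6ℓx` at the sites of `S`, `x := Lⁱ(δ + 30ℓs₀)` (B2's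
  induction with the triple of reads `(Ū₀ⁱ: x, U̿ⁱ: x + σ, difference: σ)` fed to `hstep`∕`hframe` at every level).
HONEST FRAMING.  Bookkeeping∕induction only; the one-step estimates are W1's (displayed, abstract constant `C₁ ≥ 2`, smallness `120ℓ(s₀+s₁) ≤ 1`); constants crude (`D = 16C₁ + 2`, `6ℓ`), not print's;
the T³∕`RegPr` reading (cluster axial gauge via W0 ⧗p616032, `L^kδ ≈ 2e`, `30ℓL^ks_B ≈ 2700Lε₀`) is W3's; nothing of print is asserted; flat twin at `U₀ = 1` (J1): ✓B2 via `dbarCovIterU_one`.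
`--supports stmt-QuantumFields-19200 --as helper`.

References: T. Bałaban, CMP 98 (1985) 17–51 [Balaban1985Averaging] ((89)–(92) p.31, (97) p.32, (127) p.37, Prop. 4 (134)–(135) p.38, (159)–(163) p.42, p.44).
-/

set_option autoImplicit false

noncomputable section

open scoped BigOperators

namespace Summit.QuantumFields.YangMills.Theorems.Prop7SymFrameIterSmall

open Literature.MathematicalPhysics.QuantumFieldTheory.Balaban1983to89
open T4Continuum BlockAveraging
open B5Eq118OneStroke (iterBlockOf iterBlockOf_succ iterBlockOf_zero)
open Summit.QuantumFields.YangMills.Theorems.Prop8Chart (emlAvgU emlIterU emlIterU_zero emlIterU_succ norm_emlIterU_sub_one_le_of_reads norm_inv_sub_one_le_two_mul)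
open Summit.QuantumFields.YangMills.Theorems.Prop7SymAvgTwSym (vframeCovU dbarCovU dbarCovIterU frameAccU dbarCovIterU_zero dbarCovIterU_succ frameAccU_zero frameAccU_succ)

variable {P : Params}
variable {𝔸 : Type*} [NormedRing 𝔸] [NormedAlgebra ℂ 𝔸] [CompleteSpace 𝔸] [NormOneClass 𝔸]

/-! ## §1 Arithmetic of the two-field step -/

omit [NormedAlgebra ℂ 𝔸] [CompleteSpace 𝔸] [NormOneClass 𝔸] in
/-- `‖ab − 1‖ ≤ ‖a − 1‖ + ‖b − 1‖ + ‖a − 1‖·‖b − 1‖` (any normed ring). [folklore] -/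
theorem norm_mul_sub_one_le_three (a b : 𝔸) : ‖a * b - 1‖ ≤ ‖a - 1‖ + ‖b - 1‖ + ‖a - 1‖ * ‖b - 1‖ := by
  have e : a * b - 1 = (a - 1) + (b - 1) + (a - 1) * (b - 1) := by noncomm_ring
  rw [e]
  exact (norm_add_le _ _).trans (add_le_add (norm_add_le _ _) (norm_mul_le _ _))

omit [NormedAlgebra ℂ 𝔸] [CompleteSpace 𝔸] [NormOneClass 𝔸] in
/-- `‖X − Y‖ ≤ ‖X·Y⁻¹ − 1‖·‖Y‖` for a unit `Y`. [folklore] -/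
theorem norm_sub_le_norm_mul_inv_sub_one_mul (X : 𝔸) (Y : 𝔸ˣ) : ‖X - (Y : 𝔸)‖ ≤ ‖X * ((Y⁻¹ : 𝔸ˣ) : 𝔸) - 1‖ * ‖(Y : 𝔸)‖ := by
  have e : X - (Y : 𝔸) = (X * ((Y⁻¹ : 𝔸ˣ) : 𝔸) - 1) * (Y : 𝔸) := by
    rw [sub_mul, one_mul, mul_assoc, Units.inv_mul, mul_one]
  rw [e]; exact norm_mul_le _ _

/-- **BUDGET CONSEQUENCES**: `8Dℓ²(Lx) ≤ 1` with `2 ≤ L ≤ ℓ`, `34 ≤ D`, `x ≥ 0` gives `ℓx ≤ 1∕544`, `Dℓ²x ≤ 1∕16`, `L²Dx ≤ 1∕8`. [folklore] -/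
theorem budget_consequences {L ℓ x D : ℝ} (hL : 2 ≤ L) (hℓ : L ≤ ℓ) (hD : 34 ≤ D) (hx0 : 0 ≤ x) (hbud : 8 * D * ℓ ^ 2 * (L * x) ≤ 1) :
    ℓ * x ≤ 1 / 544 ∧ D * ℓ ^ 2 * x ≤ 1 / 16 ∧ L ^ 2 * D * x ≤ 1 / 8 := by
  have hD0 : 0 ≤ D := by linarith
  have hℓ2 : 2 ≤ ℓ := hL.trans hℓ
  have hℓ0 : 0 ≤ ℓ := by linarith
  have hL0 : 0 ≤ L := by linarith
  have p1 : 0 ≤ (D - 34) * (ℓ ^ 2 * (L * x)) := mul_nonneg (by linarith) (by positivity)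
  have p2 : 0 ≤ ℓ ^ 2 * ((L - 2) * x) := mul_nonneg (sq_nonneg ℓ) (mul_nonneg (by linarith) hx0)
  have p3 : 0 ≤ (ℓ ^ 2 - ℓ) * x := mul_nonneg (by nlinarith) hx0
  have p4 : 0 ≤ D * ℓ ^ 2 * ((L - 2) * x) := mul_nonneg (by positivity) (mul_nonneg (by linarith) hx0)
  have p5 : 0 ≤ D * ((ℓ ^ 2 - L ^ 2) * x) := mul_nonneg hD0 (mul_nonneg (by nlinarith) hx0)
  have p6 : 0 ≤ D * (L ^ 2 * ((L - 1) * x)) := by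
    have : 0 ≤ (L - 1) * x := mul_nonneg (by linarith) hx0
    positivity
  refine ⟨?_, ?_, ?_⟩
  · rw [le_div_iff₀ (by norm_num)]; nlinarith
  · rw [le_div_iff₀ (by norm_num)]; nlinarith
  · rw [le_div_iff₀ (by norm_num)]; nlinarith

/-- **THE DIFFERENCE STEP CLOSES**: with `σ = x(1 + Dℓ²x)`, `D = 16C₁ + 2`, under `8Dℓ²(Lx) ≤ 1` (`2 ≤ L ≤ ℓ`, `2 ≤ C₁`):
`(Lσ + 16C₁ℓ²x²)(1 + Lx) ≤ (Lx)(1 + Dℓ²(Lx))`. [folklore] -/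
theorem step_budget_cov {L ℓ x σ C₁ D : ℝ} (hL : 2 ≤ L) (hℓ : L ≤ ℓ) (hC₁ : 2 ≤ C₁) (hD : D = 16 * C₁ + 2) (hx0 : 0 ≤ x)
    (hσ : σ = x * (1 + D * ℓ ^ 2 * x)) (hbud : 8 * D * ℓ ^ 2 * (L * x) ≤ 1) :
    (L * σ + 16 * C₁ * ℓ ^ 2 * x ^ 2) * (1 + L * x) ≤ L * x * (1 + D * ℓ ^ 2 * (L * x)) := by
  have hD34 : 34 ≤ D := by rw [hD]; linarith
  have hD0 : 0 < D := by linarith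
  have hℓL : L ^ 2 ≤ ℓ ^ 2 := pow_le_pow_left₀ (by linarith) hℓ 2
  obtain ⟨-, -, h1⟩ := budget_consequences hL hℓ hD34 hx0 hbud
  -- `16C₁Lx ≤ DLx ≤ L²Dx ≤ 1∕8` (using `16C₁ ≤ D`, `1 ≤ L`)
  have h2 : 16 * C₁ * L * x ≤ 1 / 8 := by
    have h16 : 16 * C₁ ≤ D := by rw [hD]; linarith
    have hLx0 : 0 ≤ L * x := mul_nonneg (by linarith) hx0
    have a1 : 16 * C₁ * L * x ≤ D * (L * x) := by nlinarith
    have a2 : D * (L * x) ≤ L ^ 2 * D * x := by nlinarith [mul_nonneg hD0.le (mul_nonneg (by linarith : (0:ℝ) ≤ L - 1) hLx0)]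
    linarith
  have hx2 : 0 ≤ x ^ 2 := sq_nonneg x
  have key : (L ^ 2 * D * ℓ ^ 2 + 16 * C₁ * ℓ ^ 2 * L) * x ≤ (16 * C₁ + 3) * ℓ ^ 2 := by
    have e : (L ^ 2 * D * ℓ ^ 2 + 16 * C₁ * ℓ ^ 2 * L) * x = ℓ ^ 2 * (L ^ 2 * D * x + 16 * C₁ * L * x) := by ring
    rw [e]; nlinarith [sq_nonneg ℓ]
  have hA : 2 * D * ℓ ^ 2 ≤ D * L ^ 2 * ℓ ^ 2 - L * D * ℓ ^ 2 := by
    have hq : 0 ≤ L ^ 2 - L - 2 := by nlinarith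
    nlinarith [mul_nonneg (mul_nonneg hD0.le (sq_nonneg ℓ)) hq]
  have hD2 : 2 * D * ℓ ^ 2 = (32 * C₁ + 4) * ℓ ^ 2 := by rw [hD]; ring
  have hmain : L * D * ℓ ^ 2 + 16 * C₁ * ℓ ^ 2 + L ^ 2 + (L ^ 2 * D * ℓ ^ 2 + 16 * C₁ * ℓ ^ 2 * L) * x ≤ D * L ^ 2 * ℓ ^ 2 := by
    linarith [key, hℓL, hA, hD2]
  have e1 : (L * σ + 16 * C₁ * ℓ ^ 2 * x ^ 2) * (1 + L * x)
      = L * x + (L * D * ℓ ^ 2 + 16 * C₁ * ℓ ^ 2 + L ^ 2 + (L ^ 2 * D * ℓ ^ 2 + 16 * C₁ * ℓ ^ 2 * L) * x) * x ^ 2 := by rw [hσ]; ring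
  have e2 : L * x * (1 + D * ℓ ^ 2 * (L * x)) = L * x + (D * L ^ 2 * ℓ ^ 2) * x ^ 2 := by ring
  rw [e1, e2]
  linarith [mul_le_mul_of_nonneg_right hmain hx2]

/-- **THE FRAME STEP CLOSES**: `Φ ≤ 6ℓx`, `f ≤ ℓσ + 16C₁ℓ²x²` ⟹ `Φ + f + Φf ≤ 6ℓ(Lx)` under the same budget. [folklore] -/
theorem step_frame_cov {L ℓ x σ C₁ D Φ f : ℝ} (hL : 2 ≤ L) (hℓ : L ≤ ℓ) (hC₁ : 2 ≤ C₁) (hD : D = 16 * C₁ + 2) (hx0 : 0 ≤ x)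
    (hσ : σ = x * (1 + D * ℓ ^ 2 * x)) (hbud : 8 * D * ℓ ^ 2 * (L * x) ≤ 1)
    (hΦ0 : 0 ≤ Φ) (hΦ : Φ ≤ 6 * ℓ * x) (hf0 : 0 ≤ f) (hf : f ≤ ℓ * σ + 16 * C₁ * ℓ ^ 2 * x ^ 2) :
    Φ + f + Φ * f ≤ 6 * ℓ * (L * x) := by
  have hD34 : 34 ≤ D := by rw [hD]; linarith
  have hℓ0 : 0 ≤ ℓ := by linarith
  obtain ⟨hℓx, hDx, -⟩ := budget_consequences hL hℓ hD34 hx0 hbud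
  have hσ2 : σ ≤ 2 * x := by rw [hσ]; nlinarith
  have hCx : 16 * C₁ * ℓ ^ 2 * x ^ 2 ≤ ℓ * x / 8 := by
    -- `16C₁ℓ²x² ≤ (Dℓ²x)·x ≤ x∕16 ≤ ℓx∕8`
    have h16 : 16 * C₁ ≤ D := by rw [hD]; linarith
    have a1 : 16 * C₁ * ℓ ^ 2 * x ^ 2 ≤ D * ℓ ^ 2 * x * x := by nlinarith [mul_nonneg (mul_nonneg (sq_nonneg ℓ) hx0) hx0]
    have a2 : D * ℓ ^ 2 * x * x ≤ x / 16 := by nlinarith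
    have a3 : x / 16 ≤ ℓ * x / 8 := by
      rw [div_le_div_iff₀ (by norm_num) (by norm_num)]
      nlinarith [hL.trans hℓ]
    linarith
  have hf' : f ≤ 3 * (ℓ * x) := by nlinarith
  have hΦf : Φ * f ≤ (6 * ℓ * x) * (3 * (ℓ * x)) := mul_le_mul hΦ hf' hf0 (by positivity)
  nlinarith [mul_nonneg hℓ0 hx0]

/-! ## §2 ★ The two-field tower: difference reads and accumulated frames, k-uniformly -/

set_option maxHeartbeats 400000 in
/-- ★★ **k-UNIFORM SMALLNESS OF THE COVARIANT DOUBLE-BAR TOWER RELATIVE TO THE BACKGROUND TOWER, AND OF THE ACCUMULATED SYMMETRIC FRAMES** ([Balaban1985Averaging] (159)–(163) for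
the centred∕symmetrised frames of RULING g26-№12).  DATA: a background `U₀` and a full field `W` on the fine lattice with reads `‖U₀(b) − 1‖ ≤ s₀`, `‖W(b) − U₀(b)‖ ≤ δ` under a set `S`
of level-`i` sites (cluster-gauge letters); the covariant ONE-STEP rows as displayed hypotheses — `hstep` (the relative double-bar one step, tube constant EXACTLY `L`) and `hframe` (the
one-level covariant frame), both with second-order constant `C₁` and smallness `120ℓ(s₀+s₁) ≤ 1` (their suppliers: `Prop7SymFrameOneStep`, the covariant twins of ✓`Prop8ChartDoubleBarOneStep`); the background tower's
own smallness is ✓`Prop8Chart.norm_emlIterU_sub_one_le_of_reads` (`≤ 30ℓLⁱs₀`).  CONCLUSION, with `g := δ + 30ℓs₀`, `x := Lⁱg`, `D := 16C₁ + 2`, under `6400ℓ²Lⁱs₀ ≤ 1` and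
`8Dℓ²Lⁱg ≤ 1`: on the `i`-bonds `e` with both ends in `S`, `‖U̿^{(i)}(e) − Ū₀^{(i)}(e)‖ ≤ x(1 + Dℓ²x) (≤ 2x)`; at the sites `y ∈ S`, `‖w^{(i)}(y) − 1‖ ≤ 6ℓx` — both LINEAR in
`Lⁱ(δ + 30ℓs₀)`, hence k-uniform at the T³ letters (`Lᵏδ ≈ 2e`, `30ℓLᵏs_B ≈ 2700Lε₀`).  Induction on the level exactly as ✓`norm_dbarIterU_sub_one_le_of_reads` (B2).
[cite: Balaban1985Averaging, (159)–(163) p.42, (97) p.32, (127) p.37, Prop. 4 (134)–(135) p.38] -/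
theorem diff_frameAccU_le_of_reads {C₁ : ℝ} (hC₁ : 2 ≤ C₁)
    (hstep : ∀ (j : ℕ), j + 1 ≤ P.m + P.K → ∀ (U₀ W : GaugeField P j 𝔸ˣ) (c : PBond P (j + 1)) (s₀ s₁ δ : ℝ), 0 ≤ s₀ → 0 ≤ s₁ → 0 ≤ δ →
      120 * (((P.d + 2) * P.L : ℕ) : ℝ) * (s₀ + s₁) ≤ 1 →
      (∀ b : PBond P j, (blockOf b.src = c.src ∨ blockOf b.src = c.tgt) → (blockOf b.tgt = c.src ∨ blockOf b.tgt = c.tgt) →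
        ‖((U₀ b : 𝔸ˣ) : 𝔸) - 1‖ ≤ s₀ ∧ ‖((W b : 𝔸ˣ) : 𝔸) - 1‖ ≤ s₁ ∧ ‖((W b : 𝔸ˣ) : 𝔸) - ((U₀ b : 𝔸ˣ) : 𝔸)‖ ≤ δ) →
      ‖((dbarCovU U₀ W c : 𝔸ˣ) : 𝔸) * (((emlAvgU U₀ c)⁻¹ : 𝔸ˣ) : 𝔸) - 1‖ ≤ (P.L : ℝ) * δ + C₁ * (((P.d + 2) * P.L : ℕ) : ℝ) ^ 2 * (s₀ + s₁) ^ 2)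
    (hframe : ∀ (j : ℕ), j + 1 ≤ P.m + P.K → ∀ (U₀ W : GaugeField P j 𝔸ˣ) (y : Site P (j + 1)) (s₀ s₁ δ : ℝ), 0 ≤ s₀ → 0 ≤ s₁ → 0 ≤ δ →
      120 * (((P.d + 2) * P.L : ℕ) : ℝ) * (s₀ + s₁) ≤ 1 →
      (∀ b : PBond P j, blockOf b.src = y → blockOf b.tgt = y →
        ‖((U₀ b : 𝔸ˣ) : 𝔸) - 1‖ ≤ s₀ ∧ ‖((W b : 𝔸ˣ) : 𝔸) - 1‖ ≤ s₁ ∧ ‖((W b : 𝔸ˣ) : 𝔸) - ((U₀ b : 𝔸ˣ) : 𝔸)‖ ≤ δ) →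
      ‖((vframeCovU U₀ W y : 𝔸ˣ) : 𝔸) - 1‖ ≤ (((P.d + 2) * P.L : ℕ) : ℝ) * δ + C₁ * (((P.d + 2) * P.L : ℕ) : ℝ) ^ 2 * (s₀ + s₁) ^ 2) :
    ∀ (i : ℕ), i ≤ P.m + P.K → ∀ (S : Set (Site P i)) (U₀ W : GaugeField P 0 𝔸ˣ) (s₀ δ : ℝ), 0 ≤ s₀ → 0 ≤ δ →
      6400 * (((P.d + 2) * P.L : ℕ) : ℝ) ^ 2 * (P.L : ℝ) ^ i * s₀ ≤ 1 →
      8 * (16 * C₁ + 2) * (((P.d + 2) * P.L : ℕ) : ℝ) ^ 2 * ((P.L : ℝ) ^ i * (δ + 30 * (((P.d + 2) * P.L : ℕ) : ℝ) * s₀)) ≤ 1 →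
      (∀ b : PBond P 0, iterBlockOf i b.src ∈ S → iterBlockOf i b.tgt ∈ S →
        ‖((U₀ b : 𝔸ˣ) : 𝔸) - 1‖ ≤ s₀ ∧ ‖((W b : 𝔸ˣ) : 𝔸) - ((U₀ b : 𝔸ˣ) : 𝔸)‖ ≤ δ) →
      (∀ e : PBond P i, e.src ∈ S → e.tgt ∈ S →
          ‖((dbarCovIterU i U₀ W e : 𝔸ˣ) : 𝔸) - ((emlIterU i U₀ e : 𝔸ˣ) : 𝔸)‖ ≤
            (P.L : ℝ) ^ i * (δ + 30 * (((P.d + 2) * P.L : ℕ) : ℝ) * s₀) *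
              (1 + (16 * C₁ + 2) * (((P.d + 2) * P.L : ℕ) : ℝ) ^ 2 * ((P.L : ℝ) ^ i * (δ + 30 * (((P.d + 2) * P.L : ℕ) : ℝ) * s₀)))) ∧
      (∀ y : Site P i, y ∈ S → ‖((frameAccU i U₀ W y : 𝔸ˣ) : 𝔸) - 1‖ ≤ 6 * (((P.d + 2) * P.L : ℕ) : ℝ) * ((P.L : ℝ) ^ i * (δ + 30 * (((P.d + 2) * P.L : ℕ) : ℝ) * s₀))) := by
  set ℓ : ℝ := (((P.d + 2) * P.L : ℕ) : ℝ) with hℓ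
  set D : ℝ := 16 * C₁ + 2 with hD
  have hL2 : (2 : ℝ) ≤ P.L := by exact_mod_cast P.hL.2
  have hL0 : (0 : ℝ) ≤ P.L := by linarith
  have hLℓ : (P.L : ℝ) ≤ ℓ := by
    rw [hℓ]; push_cast; nlinarith [show (0 : ℝ) ≤ (P.d : ℝ) from Nat.cast_nonneg _]
  have hℓ0 : (0 : ℝ) ≤ ℓ := by linarith
  have hC₁0 : 0 ≤ C₁ := by linarith
  have hD0 : 0 < D := by rw [hD]; linarith
  intro i
  induction i with
  | zero =>
    intro _ S U₀ W s₀ δ hs₀ hδ _ hbud hU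
    set g : ℝ := δ + 30 * ℓ * s₀ with hg
    have hg0 : 0 ≤ g := by positivity
    have hδg : δ ≤ g := by rw [hg]; nlinarith [mul_nonneg hℓ0 hs₀]
    refine ⟨fun e hs ht => ?_, fun y _ => ?_⟩
    · have h := (hU e (by simpa using hs) (by simpa using ht)).2
      simp only [dbarCovIterU_zero, emlIterU_zero, pow_zero, one_mul]
      have hB : 0 ≤ D * ℓ ^ 2 * g := by positivity
      nlinarith
    · simp only [frameAccU_zero, Units.val_one, sub_self, norm_zero, pow_zero, one_mul]
      positivity
  | succ i ih =>
    intro hi S U₀ W s₀ δ hs₀ hδ hbud₀ hbud hU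
    set g : ℝ := δ + 30 * ℓ * s₀ with hg
    have hg0 : 0 ≤ g := by positivity
    set x : ℝ := (P.L : ℝ) ^ i * g with hx
    have hx0 : 0 ≤ x := by positivity
    have hpow : (P.L : ℝ) ^ (i + 1) * g = P.L * x := by rw [hx, pow_succ]; ring
    rw [hpow] at hbud ⊢
    have hbud' : 8 * D * ℓ ^ 2 * ((P.L : ℝ) * x) ≤ 1 := hbud
    -- the budgets one level down
    have hxLx : x ≤ P.L * x := by nlinarith
    have hbud_i : 8 * D * ℓ ^ 2 * x ≤ 1 := (mul_le_mul_of_nonneg_left hxLx (by positivity)).trans hbud'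
    have hbud_i' : 8 * (16 * C₁ + 2) * ℓ ^ 2 * ((P.L : ℝ) ^ i * (δ + 30 * ℓ * s₀)) ≤ 1 := hbud_i
    have hbud₀_i : 6400 * ℓ ^ 2 * (P.L : ℝ) ^ i * s₀ ≤ 1 := by
      have : 6400 * ℓ ^ 2 * (P.L : ℝ) ^ i * s₀ ≤ 6400 * ℓ ^ 2 * (P.L : ℝ) ^ (i + 1) * s₀ := by
        have h1 : (P.L : ℝ) ^ i ≤ (P.L : ℝ) ^ (i + 1) := by rw [pow_succ]; nlinarith [pow_nonneg hL0 i]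
        nlinarith [mul_le_mul_of_nonneg_left h1 (by positivity : (0:ℝ) ≤ 6400 * ℓ ^ 2 * s₀)]
      exact this.trans hbud₀
    -- small consequences of the budget
    have hD34 : 34 ≤ D := by rw [hD]; linarith
    obtain ⟨hℓx, hDx, -⟩ := budget_consequences hL2 hLℓ hD34 hx0 hbud'
    -- the level-`i` sizes
    set σ : ℝ := x * (1 + D * ℓ ^ 2 * x) with hσ
    have hσ0 : 0 ≤ σ := by positivity
    have hσ2 : σ ≤ 2 * x := by
      have h := mul_le_mul_of_nonneg_left hDx hx0
      rw [hσ]; nlinarith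
    have h48 : 120 * ℓ * (x + (x + σ)) ≤ 1 := by
      have h := mul_le_mul_of_nonneg_left hσ2 hℓ0
      nlinarith
    have hxe : x = (P.L : ℝ) ^ i * δ + 30 * ℓ * (P.L : ℝ) ^ i * s₀ := by rw [hx, hg]; ring
    have hLiδ : 0 ≤ (P.L : ℝ) ^ i * δ := by positivity
    -- the induction hypothesis one level down, on `B⁻¹ S`
    set S' : Set (Site P i) := {y | blockOf y ∈ S} with hS'
    have hU' : ∀ b : PBond P 0, iterBlockOf i b.src ∈ S' → iterBlockOf i b.tgt ∈ S' →
        ‖((U₀ b : 𝔸ˣ) : 𝔸) - 1‖ ≤ s₀ ∧ ‖((W b : 𝔸ˣ) : 𝔸) - ((U₀ b : 𝔸ˣ) : 𝔸)‖ ≤ δ :=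
      fun b hs ht => hU b (by rw [iterBlockOf_succ]; exact hs) (by rw [iterBlockOf_succ]; exact ht)
    obtain ⟨hIH, hIHw⟩ := ih (Nat.le_of_succ_le hi) S' U₀ W s₀ δ hs₀ hδ hbud₀_i hbud_i' hU'
    -- the background tower at level `i` on `S'` (black box) : `≤ 30ℓLⁱs₀ ≤ x`
    have hα : ∀ b : PBond P i, b.src ∈ S' → b.tgt ∈ S' → ‖((emlIterU i U₀ b : 𝔸ˣ) : 𝔸) - 1‖ ≤ x := by
      intro b hs ht
      have h := norm_emlIterU_sub_one_le_of_reads (Nat.le_of_succ_le hi) S' U₀ hs₀ hbud₀_i (fun b' hs' ht' => (hU' b' hs' ht').1) b hs ht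
      refine h.trans ?_
      rw [← hℓ]; linarith
    -- and at level `i+1` on `S` : `≤ 30ℓL^{i+1}s₀ ≤ Lx`
    have hα1 : ∀ c : PBond P (i + 1), c.src ∈ S → c.tgt ∈ S → ‖((emlIterU (i + 1) U₀ c : 𝔸ˣ) : 𝔸) - 1‖ ≤ P.L * x := by
      intro c hs ht
      have h := norm_emlIterU_sub_one_le_of_reads hi S U₀ hs₀ hbud₀ (fun b' hs' ht' => (hU b' hs' ht').1) c hs ht
      refine h.trans ?_
      have e : 30 * ℓ * (P.L : ℝ) ^ (i + 1) * s₀ = P.L * (30 * ℓ * (P.L : ℝ) ^ i * s₀) := by rw [pow_succ]; ring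
      rw [← hℓ, e]
      exact mul_le_mul_of_nonneg_left (by linarith) hL0
    -- reads of the two level-`i` tower fields on the two blocks of a level-`(i+1)` bond in `S`, and on one block
    have hreads2 : ∀ c : PBond P (i + 1), c.src ∈ S → c.tgt ∈ S → ∀ b : PBond P i,
        (blockOf b.src = c.src ∨ blockOf b.src = c.tgt) → (blockOf b.tgt = c.src ∨ blockOf b.tgt = c.tgt) →
        ‖((emlIterU i U₀ b : 𝔸ˣ) : 𝔸) - 1‖ ≤ x ∧ ‖((dbarCovIterU i U₀ W b : 𝔸ˣ) : 𝔸) - 1‖ ≤ x + σ ∧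
          ‖((dbarCovIterU i U₀ W b : 𝔸ˣ) : 𝔸) - ((emlIterU i U₀ b : 𝔸ˣ) : 𝔸)‖ ≤ σ := by
      intro c hcs hct b hbs hbt
      have hs' : b.src ∈ S' := by
        show blockOf b.src ∈ S
        rcases hbs with h | h <;> rw [h]
        exacts [hcs, hct]
      have ht' : b.tgt ∈ S' := by
        show blockOf b.tgt ∈ S
        rcases hbt with h | h <;> rw [h]
        exacts [hcs, hct]
      have h1 := hα b hs' ht'
      have h2 := hIH b hs' ht'
      refine ⟨h1, ?_, h2⟩
      calc ‖((dbarCovIterU i U₀ W b : 𝔸ˣ) : 𝔸) - 1‖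
          ≤ ‖((dbarCovIterU i U₀ W b : 𝔸ˣ) : 𝔸) - ((emlIterU i U₀ b : 𝔸ˣ) : 𝔸)‖ + ‖((emlIterU i U₀ b : 𝔸ˣ) : 𝔸) - 1‖ := norm_sub_le_norm_sub_add_norm_sub _ _ _
        _ ≤ σ + x := add_le_add h2 h1
        _ = x + σ := add_comm _ _
    have hreads1 : ∀ y : Site P (i + 1), y ∈ S → ∀ b : PBond P i, blockOf b.src = y → blockOf b.tgt = y →
        ‖((emlIterU i U₀ b : 𝔸ˣ) : 𝔸) - 1‖ ≤ x ∧ ‖((dbarCovIterU i U₀ W b : 𝔸ˣ) : 𝔸) - 1‖ ≤ x + σ ∧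
          ‖((dbarCovIterU i U₀ W b : 𝔸ˣ) : 𝔸) - ((emlIterU i U₀ b : 𝔸ˣ) : 𝔸)‖ ≤ σ := by
      intro y hy b hbs hbt
      have hs' : b.src ∈ S' := by show blockOf b.src ∈ S; rw [hbs]; exact hy
      have ht' : b.tgt ∈ S' := by show blockOf b.tgt ∈ S; rw [hbt]; exact hy
      have h1 := hα b hs' ht'
      have h2 := hIH b hs' ht'
      refine ⟨h1, ?_, h2⟩
      calc ‖((dbarCovIterU i U₀ W b : 𝔸ˣ) : 𝔸) - 1‖
          ≤ ‖((dbarCovIterU i U₀ W b : 𝔸ˣ) : 𝔸) - ((emlIterU i U₀ b : 𝔸ˣ) : 𝔸)‖ + ‖((emlIterU i U₀ b : 𝔸ˣ) : 𝔸) - 1‖ := norm_sub_le_norm_sub_add_norm_sub _ _ _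
        _ ≤ σ + x := add_le_add h2 h1
        _ = x + σ := add_comm _ _
    have hx2 : 0 ≤ x + σ := by positivity
    have hquad : C₁ * ℓ ^ 2 * (x + (x + σ)) ^ 2 ≤ 16 * C₁ * ℓ ^ 2 * x ^ 2 := by
      have h4 : x + (x + σ) ≤ 4 * x := by linarith
      have hsq : (x + (x + σ)) ^ 2 ≤ (4 * x) ^ 2 := pow_le_pow_left₀ (add_nonneg hx0 hx2) h4 2
      have hc : C₁ * ℓ ^ 2 * (x + (x + σ)) ^ 2 ≤ C₁ * ℓ ^ 2 * (4 * x) ^ 2 := mul_le_mul_of_nonneg_left hsq (by positivity)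
      have he : C₁ * ℓ ^ 2 * (4 * x) ^ 2 = 16 * C₁ * ℓ ^ 2 * x ^ 2 := by ring
      linarith
    refine ⟨fun c hcs hct => ?_, fun y hy => ?_⟩
    · -- the difference at level `i+1`: the relative one step (hstep), then `‖X − Y‖ ≤ ‖XY⁻¹ − 1‖·‖Y‖`
      have hrel := hstep i hi (emlIterU i U₀) (dbarCovIterU i U₀ W) c x (x + σ) σ hx0 hx2 hσ0 h48 (hreads2 c hcs hct)
      rw [dbarCovIterU_succ, emlIterU_succ]
      have hY : ‖((emlAvgU (emlIterU i U₀) c : 𝔸ˣ) : 𝔸)‖ ≤ 1 + P.L * x := by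
        have h := hα1 c hcs hct
        rw [emlIterU_succ] at h
        calc ‖((emlAvgU (emlIterU i U₀) c : 𝔸ˣ) : 𝔸)‖ = ‖(((emlAvgU (emlIterU i U₀) c : 𝔸ˣ) : 𝔸) - 1) + 1‖ := by rw [sub_add_cancel]
          _ ≤ ‖((emlAvgU (emlIterU i U₀) c : 𝔸ˣ) : 𝔸) - 1‖ + ‖(1 : 𝔸)‖ := norm_add_le _ _
          _ ≤ P.L * x + 1 := add_le_add h (by rw [norm_one])
          _ = 1 + P.L * x := add_comm _ _
      refine (norm_sub_le_norm_mul_inv_sub_one_mul ((dbarCovU (emlIterU i U₀) (dbarCovIterU i U₀ W) c : 𝔸ˣ) : 𝔸) (emlAvgU (emlIterU i U₀) c)).trans ?_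
      have hrel' : ‖((dbarCovU (emlIterU i U₀) (dbarCovIterU i U₀ W) c : 𝔸ˣ) : 𝔸) * (((emlAvgU (emlIterU i U₀) c)⁻¹ : 𝔸ˣ) : 𝔸) - 1‖
          ≤ P.L * σ + 16 * C₁ * ℓ ^ 2 * x ^ 2 := by
        exact hrel.trans (by linarith [hquad])
      calc _ ≤ (P.L * σ + 16 * C₁ * ℓ ^ 2 * x ^ 2) * (1 + P.L * x) :=
            mul_le_mul hrel' hY (norm_nonneg _) (by positivity)
        _ ≤ P.L * x * (1 + D * ℓ ^ 2 * (P.L * x)) := step_budget_cov hL2 hLℓ hC₁ hD hx0 hσ hbud'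
    · -- the accumulated frame at level `i+1`: `w_{i+1}(y) = w_i(emb y)·v_i(y)`
      have hemb : emb y ∈ S' := by show blockOf (emb y) ∈ S; rw [Site.blockOf_emb hi]; exact hy
      have hΦ := hIHw (emb y) hemb
      have hf := hframe i hi (emlIterU i U₀) (dbarCovIterU i U₀ W) y x (x + σ) σ hx0 hx2 hσ0 h48 (hreads1 y hy)
      have hf' : ‖((vframeCovU (emlIterU i U₀) (dbarCovIterU i U₀ W) y : 𝔸ˣ) : 𝔸) - 1‖ ≤ ℓ * σ + 16 * C₁ * ℓ ^ 2 * x ^ 2 := by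
        exact hf.trans (by linarith [hquad])
      have harith := step_frame_cov hL2 hLℓ hC₁ hD hx0 hσ hbud' (norm_nonneg _) hΦ (norm_nonneg _) hf'
      rw [frameAccU_succ, Units.val_mul]
      exact (norm_mul_sub_one_le_three _ _).trans harith

end Summit.QuantumFields.YangMills.Theorems.Prop7SymFrameIterSmall

end
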